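import Summits.QuantumFields.YangMills.Theorems.InfiniteVolumeMomentBounds
import Summits.QuantumFields.YangMills.Theorems.BalabanLadderUVTorusClassDefs
import Summits.QuantumFields.YangMills.Theorems.BalabanLadderInfVolCeilingsDefs
import HarnessLib

/-!
# Infinite volume by compactness, class-parametric form: E0′ ceilings on the tori of ANY class of raw sides pass to
# the thermodynamic limit states taken along that class (the infinite-volume half of the junction currency (c′))

HONEST FRAMING (cell `ym-fleet`, seat `ym-infvol-p2`, director-ym R136 (i) «INFINITE-VOLUME ∕ CONTINUUM-FROM-UV»;
count-neutral helper for the route owner's RULING of record on the «torus parity» junction — ym-beyond-p2 g20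
2026-08-26T18:17:23Z, ADOPTED DIRECTION (c′): the junction currency is CLASS-parametric over RAW torus sides, typed by
seat ym-osasm-p1 as `TorusClass.MomentBounds6OnSides G r a 𝓣` (p464599); and (E): an infinite-volume route fed
DIRECTLY by Track A reads its states on Track A's own (even) family tori).  Pure soft analysis, kernel-checked.
The ceilings `MomentBounds6OnSides G r a 𝓣` are a HYPOTHESIS (owed E0′); NOTHING is asserted about Bałaban's
renormalisation group, uniqueness of the infinite-volume state, a mass gap, or Clay.  Decision-independent of the
statement-level question KNIT 5∕(α): the file only records what the infinite-volume side inherits from whichever side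
class the UV side produces.

WHAT IS PROVED ([folklore] throughout; steps 1, 4, 5 of `InfiniteVolumeMomentBounds` with `2S+1 ↦ N_k+1 ∈ 𝓣`).
* §1 `valMinAbs_intCast_of_two_mul_abs_lt`, `eventually_torusSeparated_sides` — `ℤ⁴`-separation in some coordinate
  is cyclic separation in `ZMod (N_k+1)` for `k` large, along ANY strictly increasing raw side sequence (no parity).
* §2 **`stateMomentStr_le_of_momentBounds6OnSides`** — the inner inequality of `MomentBounds6OnSides` at the sides
  `N_k + 1 ∈ 𝓣` passes, with the SAME constants, to every state `μ` with `IsInfiniteVolumeLimitAlong r.ρ β N μ`: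
  `|stateMomentStr G r μ n q x| ≤ (C/R⁴)ⁿ` for valid `q`, `1 ≤ R`, `R·a β ≤ ℓ₄` and `ℤ⁴`-separation `2R+4`
  (per-torus-centred moments → `μ`-centred moment, `tendsto_wilsonExpectation_centred_prod`; the side condition
  `8R+16 ≤ N_k+1` and the cyclic separation hold eventually).
* §3 **`momentBounds6On_of_onSides : MomentBounds6OnSides G r a 𝓣 → MomentBounds6On G r a (limit states along 𝓣)`**
  (p1's volume-free predicate, the state class written inline:
  `β ↦ {μ | ∃ N, StrictMono N ∧ (∀ k, N k + 1 ∈ 𝓣) ∧ IsInfiniteVolumeLimitAlong r.ρ β N μ}`); instances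
  `momentBounds6IV_of_onSides_univ` (`𝓣 = univ` ⇒ `MomentBounds6IV`), `momentBounds6TL_of_onSides_odd`
  (`𝓣 = {M | Odd M}` ⇒ `MomentBounds6TL`), and `momentBounds6On_familyLimit_of_onSides_family` (`𝓣 = familySides`:
  ceilings for the states built along Track A's own family tori `2·L^{m+K}`).
* §4 `exists_strictMono_forall_limitAlong_sides` — Tychonoff, parity-free: for ANY raw side sequence `E` and
  couplings `β_k` there are ONE strictly increasing `φ` and probability measures `μ_k` with
  `IsInfiniteVolumeLimitAlong r.ρ (β k) (E ∘ φ) (μ k)` for all `k`; `exists_strictMono_forall_limitAlong_of_unbounded`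
  — for an unbounded class `𝓣` (e.g. `familySides`, `TorusClass.familySides_unbounded`) the state class of §3 is
  inhabited at every coupling, jointly along one side sequence.

References: E. Seiler, LNP 159 (1982) Ch. 2; S. Chatterjee, arXiv:1803.01950 §2; J. Glimm, A. Jaffe, Quantum Physics
(1987) §6.1; A. Jaffe, E. Witten (2006) §5; T. Bałaban, CMP 109 (1987) 249, (0.1) (the family tori).
-/

set_option autoImplicit false

noncomputable section

open scoped BigOperators
open MeasureTheory Filter Topology
open Literature.MathematicalPhysics.QuantumFieldTheory hiding ZdEdge
open Literature.MathematicalPhysics.QuantumLattice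
open Summit.QuantumFields.YangMills.Cruxes.OSLegsFromFemtoAndGap.DlrCollarTransfer
  (plane continuous_plane exists_abs_plane_le isCylinder_plane)
open Summit.QuantumFields.YangMills.Cruxes.UV.TorusClass (torusEOn MomentBounds6OnSides familySides)

namespace Summit.QuantumFields.YangMills.Theorems.InfiniteVolume

/-! ## §1 `ℤ⁴`-separation is cyclic separation on all large tori of a raw side sequence -/

section Separation

/-- No wrap-around below half the period, raw modulus: `2|z| < M ⇒ valMinAbs (z mod M) = z`. [folklore] -/
theorem valMinAbs_intCast_of_two_mul_abs_lt {M : ℕ} [NeZero M] {z : ℤ} (hz : 2 * |z| < (M : ℤ)) :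
    ((z : ZMod M)).valMinAbs = z := by
  rw [ZMod.valMinAbs_spec]
  refine ⟨rfl, ?_, ?_⟩ <;> [linarith [abs_nonneg z, neg_abs_le z, le_abs_self z]; linarith [le_abs_self z]]

/-- **`ℤ⁴`-separation ⇒ cyclic separation, eventually, along ANY strictly increasing raw side sequence.**  If the
sites `x i` are pairwise `D`-separated in some coordinate of `ℤ⁴`, then along a strictly increasing `N` they are
eventually pairwise `D`-separated in the torus sense on `(ℤ/(N_k+1)ℤ)⁴` (`valMinAbs` of the difference read in
`ZMod (N k + 1)`), whatever the parity of the sides. [folklore] -/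
theorem eventually_torusSeparated_sides {n : ℕ} (x : Fin n → (Fin 4 → ℤ)) {D : ℤ}
    (hsep : ∀ i j : Fin n, i ≠ j → ∃ m : Fin 4, D ≤ |x i m - x j m|) {N : ℕ → ℕ} (hN : StrictMono N) :
    ∀ᶠ k in atTop, ∀ i j : Fin n, i ≠ j → ∃ m : Fin 4,
      D ≤ |((((x i m - x j m : ℤ) : ZMod (N k + 1))).valMinAbs : ℤ)| := by
  obtain ⟨Mb, hMb⟩ := exists_abs_sub_le x
  filter_upwards [eventually_le_of_strictMono hN (2 * Mb)] with k hk i j hij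
  obtain ⟨m, hm⟩ := hsep i j hij
  refine ⟨m, ?_⟩
  have hk' : ((2 * Mb : ℕ) : ℤ) ≤ N k := by exact_mod_cast hk
  have hlt : 2 * |x i m - x j m| < ((N k + 1 : ℕ) : ℤ) := by
    have := hMb i j m
    push_cast at hk' ⊢
    linarith
  rwa [valMinAbs_intCast_of_two_mul_abs_lt hlt]

end Separation

/-! ## §2 The inheritance along a class of raw sides -/

section Inheritance

variable {G : Type} [Group G] [TopologicalSpace G] [IsTopologicalGroup G] [CompactSpace G]
  [MeasurableSpace G] [BorelSpace G]

/-- **THE CLASS-PARAMETRIC INHERITANCE.**  Let the inner inequality of `MomentBounds6OnSides G r a 𝓣` hold with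
constants `(C, β₄, ℓ₄)` (per-torus-centred mixed moments of single-plane fields at cyclically separated sites are
`≤ (C/R⁴)ⁿ` on every torus `(ℤ/Mℤ)⁴` with `M ∈ 𝓣`, `8R+16 ≤ M`, for `β ≥ β₄`, `1 ≤ R`, `R·a β ≤ ℓ₄`).  Then for every
`β ≥ β₄`, every strictly increasing `N` with `N k + 1 ∈ 𝓣` and EVERY state `μ` with `IsInfiniteVolumeLimitAlong r.ρ β N μ`,
every plane string `q` at sites `x` of `ℤ⁴` pairwise `2R+4`-separated in some coordinate:
`|stateMomentStr G r μ n q x| ≤ (C/R⁴)ⁿ` — same constants, no side condition left. [folklore] -/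
theorem stateMomentStr_le_of_momentBounds6OnSides (r : LatticeRep G) {a : ℝ → ℝ} {𝓣 : Set ℕ} {C β₄ ℓ₄ : ℝ}
    (H : ∀ β : ℝ, β₄ ≤ β → ∀ (M : ℕ) [NeZero M], M ∈ 𝓣 →
      ∀ (n : ℕ) (q : Fin n → Fin 4 × Fin 4) (x : Fin n → (Fin 4 → ℤ)) (R : ℕ), (∀ i, (q i).1 < (q i).2) →
        1 ≤ R → (R : ℝ) * a β ≤ ℓ₄ → 8 * R + 16 ≤ M →
        (∀ i j : Fin n, i ≠ j → ∃ k : Fin 4,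
          (2 * (R : ℤ) + 4) ≤ |((((x i k - x j k : ℤ) : ZMod M)).valMinAbs : ℤ)|) →
        |torusEOn G r β M (fun U => ∏ i, (plane G r (q i) (x i) U - torusEOn G r β M (plane G r (q i) (x i))))| ≤
          (C / (R : ℝ) ^ 4) ^ n)
    {β : ℝ} (hβ : β₄ ≤ β) {N : ℕ → ℕ} (hN : StrictMono N) (hN𝓣 : ∀ k, N k + 1 ∈ 𝓣)
    {μ : Measure (LGConfig 4 G)} (hμ : IsInfiniteVolumeLimitAlong (d := 4) r.ρ β N μ)
    {n : ℕ} (q : Fin n → Fin 4 × Fin 4) (x : Fin n → (Fin 4 → ℤ)) (R : ℕ) (hq : ∀ i, (q i).1 < (q i).2)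
    (hR : 1 ≤ R) (hRa : (R : ℝ) * a β ≤ ℓ₄)
    (hsep : ∀ i j : Fin n, i ≠ j → ∃ k : Fin 4, (2 * (R : ℤ) + 4) ≤ |x i k - x j k|) :
    |stateMomentStr G r μ n q x| ≤ (C / (R : ℝ) ^ 4) ^ n := by
  obtain ⟨Cp, hCp⟩ := exists_abs_plane_le (G := G) r
  unfold stateMomentStr
  refine abs_integral_centred_prod_le_of_eventually r.ρ r.continuous hμ (fun i => plane G r (q i) (x i))
    (fun i => ⟨_, isCylinder_plane r (q i) (x i)⟩) (fun i => continuous_plane r (q i) (x i))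
    (fun i => measurable_plane r (q i) (x i)) (fun i => ⟨Cp, hCp (q i) (x i)⟩) ?_
  filter_upwards [eventually_torusSeparated_sides x hsep hN, eventually_le_of_strictMono hN (8 * R + 16)]
    with k hsepk hRk
  exact H β hβ (N k + 1) (hN𝓣 k) n q x R hq hR hRa (by omega) hsepk

/-! ## §3 Packaged: `MomentBounds6OnSides 𝓣 ⟹ MomentBounds6On (limit states along 𝓣)` and its instances -/

/-- **E0′ ceilings on the tori of a raw-side class pass to the thermodynamic limit states taken along that class**:
`MomentBounds6OnSides G r a 𝓣 → MomentBounds6On G r a (β ↦ {μ | ∃ N, StrictMono N ∧ (∀ k, N k + 1 ∈ 𝓣) ∧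
IsInfiniteVolumeLimitAlong r.ρ β N μ})`, with the same constants. [folklore] -/
theorem momentBounds6On_of_onSides (r : LatticeRep G) {a : ℝ → ℝ} {𝓣 : Set ℕ} (h : MomentBounds6OnSides G r a 𝓣) :
    MomentBounds6On G r a (fun β => {μ | ∃ N : ℕ → ℕ, StrictMono N ∧ (∀ k, N k + 1 ∈ 𝓣) ∧
      IsInfiniteVolumeLimitAlong (d := 4) r.ρ β N μ}) := by
  obtain ⟨C, β₄, ℓ₄, hℓ, hC, H⟩ := h
  refine ⟨C, β₄, ℓ₄, hℓ, hC, fun β hβ μ hμ n q x R hq hR hRa hsep => ?_⟩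
  obtain ⟨N, hN, hN𝓣, hlim⟩ := hμ
  exact stateMomentStr_le_of_momentBounds6OnSides r H hβ hN hN𝓣 hlim q x R hq hR hRa hsep

/-- Instance `𝓣 = univ`: ceilings on ALL tori give p1's `MomentBounds6IV` (every torus limit point, odd or even). [folklore] -/
theorem momentBounds6IV_of_onSides_univ (r : LatticeRep G) {a : ℝ → ℝ} (h : MomentBounds6OnSides G r a Set.univ) :
    MomentBounds6IV G r a := by
  obtain ⟨C, β₄, ℓ₄, hℓ, hC, H⟩ := momentBounds6On_of_onSides r h
  refine ⟨C, β₄, ℓ₄, hℓ, hC, fun β hβ μ hμ n q x R hq hR hRa hsep => ?_⟩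
  obtain ⟨N, hN, hlim⟩ := hμ
  exact H β hβ μ ⟨N, hN, fun _ => Set.mem_univ _, hlim⟩ n q x R hq hR hRa hsep

/-- Instance `𝓣 = {M | Odd M}`: ceilings on the odd tori give p1's `MomentBounds6TL` (the odd-torus limit states
`oddTorusLimitPoints r β` are limits along `N k = 2 S k`, sides `2 S k + 1`). [folklore] -/
theorem momentBounds6TL_of_onSides_odd (r : LatticeRep G) {a : ℝ → ℝ} (h : MomentBounds6OnSides G r a {M | Odd M}) :
    MomentBounds6TL G r a := by
  obtain ⟨C, β₄, ℓ₄, hℓ, hC, H⟩ := momentBounds6On_of_onSides r h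
  refine ⟨C, β₄, ℓ₄, hℓ, hC, fun β hβ μ hμ n q x R hq hR hRa hsep => ?_⟩
  obtain ⟨S, hS, hlim⟩ := hμ
  exact H β hβ μ ⟨fun k => 2 * S k, fun i j hij => by dsimp only; have := hS hij; omega,
    fun k => ⟨S k, by ring⟩, hlim⟩ n q x R hq hR hRa hsep

/-- Instance `𝓣 = familySides` (Track A's even family tori `2·L^{m+K}`): the ceilings ON THE FAMILY TORI give the
ceilings for every infinite-volume state built along family tori — the owner's reading (E) «fed directly by Track A
⇒ states typed family-volume». [folklore] -/
theorem momentBounds6On_familyLimit_of_onSides_family (r : LatticeRep G) {a : ℝ → ℝ}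
    (h : MomentBounds6OnSides G r a familySides) :
    MomentBounds6On G r a (fun β => {μ | ∃ N : ℕ → ℕ, StrictMono N ∧ (∀ k, N k + 1 ∈ familySides) ∧
      IsInfiniteVolumeLimitAlong (d := 4) r.ρ β N μ}) :=
  momentBounds6On_of_onSides r h

end Inheritance

/-! ## §4 Limit states along any raw side sequence exist, jointly for a whole coupling sequence -/

section Joint

variable {G : Type} [Group G] [TopologicalSpace G] [IsTopologicalGroup G] [CompactSpace G]
  [MeasurableSpace G] [BorelSpace G]

/-- **Joint thermodynamic subsequence along ANY raw side sequence** (parity-free `exists_strictMono_forall_oddTorusLimit`).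
For every sequence of couplings `β : ℕ → ℝ` and every sequence of raw sides `E n + 1` there are ONE strictly
increasing `φ` and probability measures `μ_k` on `ℤ⁴` gauge fields such that, for every `k`, the torus Wilson states
at coupling `β k` on `(ℤ/(E (φ j) + 1)ℤ)⁴` converge along `j` to `μ k` on all bounded continuous cylinder observables.
Tychonoff for `ℕ → ProbabilityMeasure (LGConfig 4 G)` (compact metrisable). [folklore] -/
theorem exists_strictMono_forall_limitAlong_sides (r : LatticeRep G) (β : ℕ → ℝ) (E : ℕ → ℕ) :
    ∃ φ : ℕ → ℕ, StrictMono φ ∧ ∃ μ : ℕ → Measure (LGConfig 4 G),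
      ∀ k, IsProbabilityMeasure (μ k) ∧
        IsInfiniteVolumeLimitAlong (d := 4) r.ρ (β k) (fun j => E (φ j)) (μ k) := by
  have hρ := r.continuous
  haveI : SecondCountableTopology G := (hρ.isClosedEmbedding r.injective).isEmbedding.secondCountableTopology
  haveI : T2Space G := (hρ.isClosedEmbedding r.injective).isEmbedding.t2Space
  haveI := fun (k n : ℕ) => isProbabilityMeasure_torusState (d := 4) (L := E n + 1) r.ρ hρ (β k)
  let P : ℕ → ℕ → ProbabilityMeasure (LGConfig 4 G) := fun n k => ⟨torusState r.ρ (β k) (E n + 1), inferInstance⟩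
  obtain ⟨ν, -, φ, hφ, hlim⟩ :=
    (isCompact_univ (X := ℕ → ProbabilityMeasure (LGConfig 4 G))).tendsto_subseq fun n => Set.mem_univ (P n)
  refine ⟨φ, hφ, fun k => (ν k : Measure (LGConfig 4 G)), fun k => ⟨inferInstance, inferInstance, ?_⟩⟩
  intro F Sup _ hFc hFb
  obtain ⟨C, hC⟩ := hFb
  let Fb : BoundedContinuousFunction (LGConfig 4 G) ℝ :=
    BoundedContinuousFunction.ofNormedAddCommGroup F hFc C (fun U => by simpa [Real.norm_eq_abs] using hC U)
  have hk : Tendsto (fun j => P (φ j) k) atTop (𝓝 (ν k)) := by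
    have := (tendsto_pi_nhds.1 hlim) k
    simpa [Function.comp] using this
  have key : Tendsto (fun j : ℕ => ∫ U, Fb U ∂(P (φ j) k : Measure (LGConfig 4 G))) atTop
      (𝓝 (∫ U, Fb U ∂(ν k : Measure (LGConfig 4 G)))) :=
    (ProbabilityMeasure.tendsto_iff_forall_integral_tendsto.1 hk) Fb
  refine key.congr' (Eventually.of_forall fun j => ?_)
  exact (wilsonExpectation_toTorusObservable r.ρ (β k) (E (φ j) + 1) hFc.measurable).symm

/-- **For an unbounded class of raw sides the state class of §3 is inhabited at every coupling, jointly**: there are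
ONE strictly increasing `N` with all sides `N k + 1 ∈ 𝓣` and probability measures `μ_k` with
`IsInfiniteVolumeLimitAlong r.ρ (β k) N (μ k)` for every `k`. (Enumerate `{m | m + 1 ∈ 𝓣}` increasingly by `Nat.nth`,
then §4's joint subsequence.)  For Track A's class the hypothesis is `TorusClass.familySides_unbounded`
(`Theorems/BalabanLadderUVTorusClass.lean`). [folklore] -/
theorem exists_strictMono_forall_limitAlong_of_unbounded (r : LatticeRep G) (β : ℕ → ℝ) {𝓣 : Set ℕ}
    (h𝓣 : ∀ m : ℕ, ∃ M ∈ 𝓣, m ≤ M) :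
    ∃ N : ℕ → ℕ, StrictMono N ∧ (∀ k, N k + 1 ∈ 𝓣) ∧ ∃ μ : ℕ → Measure (LGConfig 4 G),
      ∀ k, IsProbabilityMeasure (μ k) ∧ IsInfiniteVolumeLimitAlong (d := 4) r.ρ (β k) N (μ k) := by
  -- the shifted class `{m | m + 1 ∈ 𝓣}` is infinite; enumerate it increasingly
  set s : Set ℕ := {m | m + 1 ∈ 𝓣} with hs
  have hsinf : s.Infinite := by
    refine Set.infinite_of_forall_exists_gt fun m => ?_
    obtain ⟨M, hM, hmM⟩ := h𝓣 (m + 2)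
    refine ⟨M - 1, ?_, by omega⟩
    show M - 1 + 1 ∈ 𝓣
    rwa [Nat.sub_add_cancel (by omega)]
  set E : ℕ → ℕ := Nat.nth (· ∈ s) with hE
  have hEmono : StrictMono E := Nat.nth_strictMono hsinf
  have hEmem : ∀ n, E n + 1 ∈ 𝓣 := fun n => by
    have : E n ∈ s := Nat.nth_mem_of_infinite hsinf n
    exact this
  obtain ⟨φ, hφ, μ, hμ⟩ := exists_strictMono_forall_limitAlong_sides r β E
  exact ⟨fun j => E (φ j), hEmono.comp hφ, fun j => hEmem (φ j), μ, hμ⟩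

end Joint

end Summit.QuantumFields.YangMills.Theorems.InfiniteVolume

end
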